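import Summits.QuantumFields.BalabanUV.T4Continuum.Spine.NE2.CovariantTablePairingMean
import Summits.QuantumFields.BalabanUV.T4Continuum.Spine.NE2.ComposedAveragingMean
import Summits.QuantumFields.BalabanUV.T4Continuum.Spine.NE2ColourPerturbedLayerRate

/-!
# T⁴ programme, spine node NE2 (U1a) — R14 W2, file 5: THE (3.26)-SHAPE END WITH PRINT's COMPOSED AVERAGING `Q_k(U) = Q(Ū^{(k−1)})⋯Q(U)` IN THE B3 SLOT, AT A RATE `ρ ≥ 3/(2L)`
# (cell `pub-balaban-gaps`, seat ne2 gen 4; plan `run/shared/lean/pub/pub-balaban-gaps/ne/NE2-R14-PLAN.md` W2 — this file closes W2)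

Inputs BY NAME: file 2's mean-weighted pairing law (`CovariantTablePairingMean.averagingLaws_EcovT_mean_rate`), file 3's entry law (`CovariantTableBalabanTwoLevel.TBal_two_level_entry`),
file 4's mean (`ComposedAveragingMean.theta_mean_TBal`, `thetaMean_le_geom`), W1's `CovariantTableTower.perturbationLaws_avgPertT_rate`, row B2/B5's
`RegularBackgroundTower.perturbationLaws_covariantLaplacian_of_regular`, the rate-`ρ` engine `NE2ColourPerturbedLayerRate.towerLimitRate_perturbed_king_kron_rate`.  PROVED:
 * **`averagingLaws_EcovT_TBal_mean`** (the composed table's `E`-datum in its OWN currency: defect `Cst·card o·(thetaMean_k + τL^{−k})`, the carry cascade's `(k+1)L^{−k}` displayed as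
   is) and **`averagingLaws_EcovT_TBal`** (the same at any rate `ρ ≥ max(θ_c, 3/(2L))`) — binders: contractive data `W^{(k)}_i`, the (3.35)-type size letter
   `‖W^{(k)}_i − 1‖ ≤ α/L^i`, the NE3-type consistency letter `‖W^{(k+1)}_i − W^{(k)}_i‖ ≤ σθ_c^k/L^i` (`i ≤ k`), NOTHING ELSE;
 * **`composed_averaging_rate`** = ROOT B ∘ tier B at rate `ρ` with PRINT's COMPOSED AVERAGING TERM `a·(n_k^d Q_k(T_Bal)ᴴQ_k(T_Bal) − QᴴQ⊗1)` ([B9] (3.16)/(3.26) `Q*(U) a Q(U)` minus its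
   free part, (3.15)'s `Q_k(U)` as the table `TBal`) in the B3 slot, CONDITIONAL on rows B5/NE3 (`hreg`, `hNE3` BY NAME), the fourth-slot law `hP₄` at rate `ρ`, the data letters on
   `W`, and the threshold `κ_B < 1`.
WHAT SEPARATES THIS FROM PRINT (r2 of the dictionary B0, located): the coarse fields `W^{(k)}_i` are DATA (intended `Ad Ū_k^{(k−i)}`, [B7] (15)'s group-valued averages of Bałaban's
minimiser — UNTYPED, DIVERGENCE F6 (ζ); that they satisfy the letters is G2 = NE3's business); [B7] (124)'s O(L²α₀) REMAINDER `Q(V₀) − Q₀` of each one-step factor is not in `TBal` (W3);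
the rate is `ρ ≥ 3/(2L)`, not `L⁻¹` — the factor `(k+1)` of file 4 is genuine for sizes-only bookkeeping (the sharp rate needs the axial-consistency + curvature letters; not here).
HONEST FRAMING (T4-DAG p. 1).  MODEL LEVEL on the tree's finite tori; every letter on `W`, `R`, `P₄` is a DISPLAYED hypothesis asserted by nobody; node NE3's `LocalRate` consumed BY
NAME (OPEN); NOT NE2, NOT [B9] (3.16)/(3.26) as printed; **NE2 (U1a) NOT PROVED**; spine PROVED 0/9 unchanged; NOT continuum YM / infinite volume / mass gap / Clay.  HONEST
DEPENDENCY: continuum YM on T⁴ ⇐ BetaPertH ∧ nine spine estimates (0/9 proved); BetaPertH ⇐ (D1) ∧ (D4) ∧ CAP+tail; G-an2-4 gates asym, D1 and NE2/3/4.  No `sorry`, no `def`.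
-/

noncomputable section

open scoped BigOperators ComplexConjugate Matrix Matrix.Norms.L2Operator Kronecker
open Finset

namespace Summit.QuantumFields.BalabanUV.T4Continuum.NE2.ComposedAveragingRate

open Literature.MathematicalPhysics.QuantumFieldTheory.Balaban1983to89.B5Prop11Plancherel (Tor fine unitVec Cst Cst_nonneg)
open Literature.MathematicalPhysics.QuantumFieldTheory.Balaban1983to89.B5Block118 (QvOp)
open Literature.MathematicalPhysics.QuantumFieldTheory.Balaban1983to89.B5G183RateUnitTower (lev lev_neZero)
open Literature.MathematicalPhysics.QuantumFieldTheory.Balaban1983to89.T4EtaRateMin (LocalRate)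
open Summit.QuantumFields.BalabanUV.T4Continuum
open Summit.QuantumFields.BalabanUV.T4Continuum.BalabanAveragedTowerUnit (idx Qlev one_le_lev' cast_lev')
open Summit.QuantumFields.BalabanUV.T4Continuum.KingPairingPlantedLaw (JpcT calDalev CJ)
open Summit.QuantumFields.BalabanUV.T4Continuum.LineAveragingPairing (glue)
open Summit.QuantumFields.BalabanUV.T4Continuum.GramPerturbationLaw (AveragingLaws C2gram)
open Summit.QuantumFields.BalabanUV.T4Continuum.CovariantAveragingTower (TowerLimitRate)
open Summit.QuantumFields.BalabanUV.T4Continuum.BackgroundResolventTower (PerturbationLaws Cpert)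
open Summit.QuantumFields.BalabanUV.T4Continuum.RegularBackgroundTower (RegularTransporters regClass perturbationLaws_covariantLaplacian_of_regular)
open Summit.QuantumFields.BalabanUV.T4Continuum.NE2FromNE3 (bgReadings)
open Summit.QuantumFields.BalabanUV.T4Continuum.CovariantAveragingSummand (kappaQ)
open Summit.QuantumFields.BalabanUV.T4Continuum.NE2BalabanLayer (tierBPert kappaB C2B perturbationLaws_add₃)
open Summit.QuantumFields.BalabanUV.T4Continuum.NE2ColourPerturbedLayerRate (perturbationLaws_rate_mono towerLimitRate_perturbed_king_kron_rate)
open Summit.QuantumFields.BalabanUV.T4Continuum.NE2.CovariantTableAveraging (Table)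
open Summit.QuantumFields.BalabanUV.T4Continuum.NE2.CovariantTableTower (EcovT avgPertT perturbationLaws_avgPertT_rate)
open Summit.QuantumFields.BalabanUV.T4Continuum.NE2.CovariantTablePairingMean (averagingLaws_EcovT_mean averagingLaws_EcovT_mean_rate)
open Summit.QuantumFields.BalabanUV.T4Continuum.NE2.CovariantTableBalaban (TBal norm_TBal_sub_one_le)
open Summit.QuantumFields.BalabanUV.T4Continuum.NE2.CovariantTableBalabanTwoLevel (cutBal cutBal_le consBal tailBal thetaBal consBal_nonneg tailBal_nonneg
  TBal_two_level_entry)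

open Summit.QuantumFields.BalabanUV.T4Continuum.NE2.ComposedAveragingMean (sizeA consC sizeA_nonneg consC_nonneg thetaMean thetaZero thetaMean_nonneg thetaMean_le_geom
  theta_mean_TBal inv_le_half geom_sum_le_two list_prod_one_add_pow_le_exp)

variable {d : ℕ}

section Data

variable (L : ℕ) [NeZero L] (M : Fin d → ℕ) [hM : ∀ μ, NeZero (M μ)] {o : Type*} [Fintype o] [DecidableEq o] [Nonempty o]

/-! ## §4 The `E`-datum and the (3.26)-shape END with the composed averaging term -/

omit [NeZero L] hM [Nonempty o] in
/-- **THE DATA CONSISTENCY FEEDS FILE 3's LETTER**: `‖W^{(k+1)}_i − W^{(k)}_i‖ ≤ consC k i` from the NE3-type letter on `i ≤ k` and contractivity beyond. [folklore] -/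
theorem consC_of_data {W : ℕ → (i : ℕ) → Fin d → (idx L M i → Matrix o o ℂ)} {σ θc : ℝ}
    (hWn : ∀ k i ν b, ‖W k i ν b‖ ≤ 1)
    (hWc : ∀ k i ν b, i ≤ k → ‖W (k + 1) i ν b - W k i ν b‖ ≤ σ * θc ^ k / (lev L i : ℕ)) (k i : ℕ) (ν : Fin d) (b : idx L M i) :
    ‖W (k + 1) i ν b - W k i ν b‖ ≤ consC L σ θc k i := by
  unfold consC
  split_ifs with h
  · refine (hWc k i ν b h).trans (le_of_eq ?_)
    rw [cast_lev', inv_pow, div_eq_mul_inv]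
  · calc ‖W (k + 1) i ν b - W k i ν b‖ ≤ ‖W (k + 1) i ν b‖ + ‖W k i ν b‖ := norm_sub_le _ _
      _ ≤ 1 + 1 := add_le_add (hWn _ _ _ _) (hWn _ _ _ _)
      _ = 2 := by norm_num

omit [NeZero L] hM [Nonempty o] in
/-- the size `α/L^i` in file-1 form. [folklore] -/
theorem sizeA_of_data {W : ℕ → (i : ℕ) → Fin d → (idx L M i → Matrix o o ℂ)} {α : ℝ}
    (hWa : ∀ k i ν b, ‖W k i ν b - 1‖ ≤ α / (lev L i : ℕ)) (k i : ℕ) (ν : Fin d) (b : idx L M i) : ‖W k i ν b - 1‖ ≤ sizeA L α i := by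
  refine (hWa k i ν b).trans (le_of_eq ?_)
  rw [sizeA, cast_lev', inv_pow, div_eq_mul_inv]

omit hM [Nonempty o] in
/-- **THE SIZE DATUM OF THE COMPOSED TABLE**: `‖TBal (W k) k − 1‖ ≤ e^{qα} − 1` (`q = (d+1)L`) from `‖W^{(k)}_i − 1‖ ≤ α/L^i`. [folklore] -/
theorem norm_TBal_sub_one_le_exp (hL : 2 ≤ L) {W : ℕ → (i : ℕ) → Fin d → (idx L M i → Matrix o o ℂ)} {α : ℝ} (hα : 0 ≤ α)
    (hWa : ∀ k i ν b, ‖W k i ν b - 1‖ ≤ α / (lev L i : ℕ)) (k : ℕ) (y : Tor M) (j : Fin d → Fin (lev L k)) (μ : Fin d) (t : ℕ) :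
    ‖TBal L M (W k) k y j μ t - 1‖ ≤ Real.exp ((((d + 1) * L : ℕ) : ℝ) * α) - 1 := by
  have h := norm_TBal_sub_one_le L M (sizeA_nonneg L hα) (sizeA_of_data L M hWa k) k y j μ t
  refine h.trans (sub_le_sub_right ?_ 1)
  have hprod := list_prod_one_add_pow_le_exp (sizeA L α) (sizeA_nonneg L hα) ((d + 1) * L) ((List.range k).map fun i' => i' + 1)
  rw [List.map_map, List.map_map] at hprod
  refine hprod.trans (Real.exp_le_exp.mpr (mul_le_mul_of_nonneg_left ?_ (Nat.cast_nonneg _)))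
  have e : ((List.range k).map ((sizeA L α) ∘ fun i' => i' + 1)).sum = α * ∑ i ∈ range k, ((L : ℝ)⁻¹) ^ (i + 1) := by
    rw [← List.sum_toFinset _ List.nodup_range, List.toFinset_range, Finset.mul_sum]; rfl
  rw [e]
  obtain ⟨h0, h2⟩ := inv_le_half hL
  have hg := geom_sum_le_two h0 h2 k
  have e2 : ∑ i ∈ range k, ((L : ℝ)⁻¹) ^ (i + 1) = (L : ℝ)⁻¹ * ∑ i ∈ range k, ((L : ℝ)⁻¹) ^ i := by
    rw [Finset.mul_sum]; exact Finset.sum_congr rfl fun i _ => by rw [pow_succ]; ring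
  rw [e2]
  have h1 : (L : ℝ)⁻¹ * ∑ i ∈ range k, ((L : ℝ)⁻¹) ^ i ≤ 1 := by nlinarith [pow_nonneg h0 k]
  exact mul_le_of_le_one_right hα h1

variable (a : ℝ) (ha : 0 < a)

/-- **THE GRAM-LAW `E`-DATUM OF BAŁABAN's COMPOSED TABLE TOWER IN ITS OWN CURRENCY** (no rate chosen): size `card o·(e^{qα} − 1)`, defect
`Cst·card o·(thetaMean_k + (e^{qα} − 1)·L^{−k})` with `thetaMean_k = qσe^{qσ}θ_c^k + 4qαe^{2qα}(k+1)L^{−k}` — the `(k+1)·L^{−k}` of the carry cascade displayed as is.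
Binders: contractive data, the size letter `α/L^i`, the consistency letter `σθ_c^k/L^i` (`i ≤ k`), NOTHING ELSE. [cite: Balaban1985BackgroundPropagators, (3.15)–(3.16) p.393 (shape)] [folklore] -/
theorem averagingLaws_EcovT_TBal_mean (hL : 2 ≤ L) {W : ℕ → (i : ℕ) → Fin d → (idx L M i → Matrix o o ℂ)} {α σ θc : ℝ}
    (hα : 0 ≤ α) (hσ : 0 ≤ σ) (hθ0 : 0 ≤ θc) (hθ1 : θc ≤ 1)
    (hWn : ∀ k i ν b, ‖W k i ν b‖ ≤ 1) (hWa : ∀ k i ν b, ‖W k i ν b - 1‖ ≤ α / (lev L i : ℕ))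
    (hWc : ∀ k i ν b, i ≤ k → ‖W (k + 1) i ν b - W k i ν b‖ ≤ σ * θc ^ k / (lev L i : ℕ)) :
    AveragingLaws (fun k => calDalev L M a ha k ⊗ₖ (1 : Matrix o o ℂ)) (EcovT L M fun k => TBal L M (W k) k) (fun k => JpcT L M k ⊗ₖ (1 : Matrix o o ℂ))
      (Fintype.card o * (Real.exp ((((d + 1) * L : ℕ) : ℝ) * α) - 1))
      (fun k => Cst d a * (Fintype.card o * (thetaMean d L α σ θc k + (Real.exp ((((d + 1) * L : ℕ) : ℝ) * α) - 1) / (lev L k : ℕ)))) := by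
  refine averagingLaws_EcovT_mean L M a ha (ϑ := fun k _ρ t' => thetaBal d L (sizeA L α) (consC L σ θc k) k (t' / L))
    (fun k => thetaMean_nonneg L hα hσ hθ0 k) (by linarith [Real.add_one_le_exp ((((d + 1) * L : ℕ) : ℝ) * α), (by positivity :
      (0 : ℝ) ≤ (((d + 1) * L : ℕ) : ℝ) * α)]) ?_ ?_ ?_
  · intro k y μ j r t' _
    exact TBal_two_level_entry L M hL (sizeA_nonneg L hα) (consC_nonneg L hσ hθ0 k) (hWn k) (hWn (k + 1)) (sizeA_of_data L M hWa k)
      (sizeA_of_data L M hWa (k + 1)) (consC_of_data L M hWn hWc k) k y μ j r t'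
  · intro k
    exact theta_mean_TBal L hL hα hσ hθ0 hθ1 k
  · intro k y μ j s _
    exact norm_TBal_sub_one_le_exp L M hL hα hWa k y j μ s

/-- **THE GRAM-LAW `E`-DATUM OF BAŁABAN's COMPOSED TABLE TOWER** `k ↦ TBal (W k) k` at any rate `ρ ≥ max(θ_c, 3/(2L))`: binders = contractive data `W^{(k)}_i`, the (3.35)-type size
letter `‖W^{(k)}_i − 1‖ ≤ α/L^i`, the NE3-type consistency letter `‖W^{(k+1)}_i − W^{(k)}_i‖ ≤ σθ_c^k/L^i` (`i ≤ k`), NOTHING ELSE; size `card o·(e^{qα} − 1)`, defect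
`(Cst·card o·(θ₀ + e^{qα} − 1))·ρ^k`. [cite: Balaban1985BackgroundPropagators, (3.15)–(3.16) p.393 (shape); Balaban1984PropagatorsI, Prop. 1.1 (1.89) p.33] [folklore] -/
theorem averagingLaws_EcovT_TBal (hL : 2 ≤ L) {W : ℕ → (i : ℕ) → Fin d → (idx L M i → Matrix o o ℂ)} {α σ θc ρ : ℝ}
    (hα : 0 ≤ α) (hσ : 0 ≤ σ) (hθ0 : 0 ≤ θc) (hθ1 : θc ≤ 1) (hθρ : θc ≤ ρ) (hρ : 3 / (2 * (L : ℝ)) ≤ ρ)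
    (hWn : ∀ k i ν b, ‖W k i ν b‖ ≤ 1) (hWa : ∀ k i ν b, ‖W k i ν b - 1‖ ≤ α / (lev L i : ℕ))
    (hWc : ∀ k i ν b, i ≤ k → ‖W (k + 1) i ν b - W k i ν b‖ ≤ σ * θc ^ k / (lev L i : ℕ)) :
    AveragingLaws (fun k => calDalev L M a ha k ⊗ₖ (1 : Matrix o o ℂ)) (EcovT L M fun k => TBal L M (W k) k) (fun k => JpcT L M k ⊗ₖ (1 : Matrix o o ℂ))
      (Fintype.card o * (Real.exp ((((d + 1) * L : ℕ) : ℝ) * α) - 1))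
      (fun k => (Cst d a * Fintype.card o * (thetaZero d L α σ + (Real.exp ((((d + 1) * L : ℕ) : ℝ) * α) - 1))) * ρ ^ k) := by
  have hL1 : 1 ≤ L := by omega
  have hLr : (1 : ℝ) ≤ L := by exact_mod_cast hL1
  have hρL : ((L : ℝ)⁻¹) ≤ ρ := by
    refine le_trans ?_ hρ
    rw [div_eq_mul_inv, mul_inv, ← mul_assoc]
    have : (0 : ℝ) ≤ (L : ℝ)⁻¹ := inv_nonneg.mpr (by linarith)
    nlinarith
  refine averagingLaws_EcovT_mean_rate L M a ha (ϑ := fun k _ρ t' => thetaBal d L (sizeA L α) (consC L σ θc k) k (t' / L))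
    (fun k => thetaMean_nonneg L hα hσ hθ0 k) (by linarith [Real.add_one_le_exp ((((d + 1) * L : ℕ) : ℝ) * α), (by positivity :
      (0 : ℝ) ≤ (((d + 1) * L : ℕ) : ℝ) * α)]) hρL (fun k => thetaMean_le_geom L hL1 hα hσ hθ0 hθρ hρ k) ?_ ?_ ?_
  · intro k y μ j r t' _
    exact TBal_two_level_entry L M hL (sizeA_nonneg L hα) (consC_nonneg L hσ hθ0 k) (hWn k) (hWn (k + 1)) (sizeA_of_data L M hWa k)
      (sizeA_of_data L M hWa (k + 1)) (consC_of_data L M hWn hWc k) k y μ j r t'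
  · intro k
    exact theta_mean_TBal L hL hα hσ hθ0 hθ1 k
  · intro k y μ j s _
    exact norm_TBal_sub_one_le_exp L M hL hα hWa k y j μ s

include ha in
omit [Nonempty o] in
/-- the covariant-Laplacian slot's consistency constant is `≥ 0` (it majorises a norm at `k = 0`). [folklore] -/
theorem C2col_nonneg_of_regular (hd : 1 ≤ d) {R : (k : ℕ) → Fin d → (idx L M k → Matrix o o ℂ)} {αR βR : ℝ} (hreg : RegularTransporters L M R αR βR)
    {C : ℝ} (hC : 0 ≤ C) (hNE3 : LocalRate (bgReadings L M (regClass L M R)) C ((L : ℝ)⁻¹)) :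
    0 ≤ ColourCovariantLaplacian.C2col o d L a αR (max βR (RegularBackgroundTower.betaNE3 o C))
      (d * (2 * αR * (RegularBackgroundTower.betaNE3 o C + βR) + 2 * RegularBackgroundTower.betaNE3 o C)) := by
  have h := (perturbationLaws_covariantLaplacian_of_regular L M a ha hd hreg hC hNE3).consistent_le 0
  rw [pow_zero, mul_one] at h
  exact (norm_nonneg _).trans h

/-- **ROOT B ∘ TIER B WITH PRINT's COMPOSED AVERAGING TERM, AT RATE `ρ`** (`L ≥ 2`, `d ≥ 1`, `max(θ_c, 3/(2L)) ≤ ρ < 1`, `t = 1`): the King-averaged colour covariances of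
`(Δ_a^{(k)} ⊗ 1 + covLap(R_k) + a·(n_k^d Q_k(T_Bal)ᴴQ_k(T_Bal) − Q_kᴴQ_k ⊗ 1) + P₄,k)⁻¹`, `Q_k(T_Bal)` = [B9] (3.15)'s composed averaging `Q(W^{(k)}_1)⋯Q(W^{(k)}_k)` of the DATA tower
of averaged fields, converge to the named limit at rate `ρ^k` — CONDITIONAL on rows B5/NE3 (`hreg`, `hNE3`), the fourth-slot law `hP₄` at rate `ρ`, the data letters on `W`
(contractive; sizes `α/L^i`; consistency `σθ_c^k/L^i`), and the threshold `κ_B < 1`.  The coarse fields are NOT constructed from Bałaban's minimiser ([B7] (15), F6 (ζ)); (124)'s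
remainder is absent (W3); NE2 NOT proved. [cite: Balaban1985BackgroundPropagators, (3.15)–(3.16) p.393, (3.26) p.395 (shape); King1986, Lemma 4.5 (4.32)/(4.38) p.674 (template)] [folklore] -/
theorem composed_averaging_rate (hL : 2 ≤ L) (hd : 1 ≤ d) {R : (k : ℕ) → Fin d → (idx L M k → Matrix o o ℂ)} {αR βR : ℝ}
    (hreg : RegularTransporters L M R αR βR) {C : ℝ} (hC : 0 ≤ C) (hNE3 : LocalRate (bgReadings L M (regClass L M R)) C ((L : ℝ)⁻¹))
    {W : ℕ → (i : ℕ) → Fin d → (idx L M i → Matrix o o ℂ)} {α σ θc ρ : ℝ}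
    (hα : 0 ≤ α) (hσ : 0 ≤ σ) (hθ0 : 0 ≤ θc) (hθ1 : θc ≤ 1) (hθρ : θc ≤ ρ) (hρ : 3 / (2 * (L : ℝ)) ≤ ρ) (hρ1 : ρ < 1)
    (hWn : ∀ k i ν b, ‖W k i ν b‖ ≤ 1) (hWa : ∀ k i ν b, ‖W k i ν b - 1‖ ≤ α / (lev L i : ℕ))
    (hWc : ∀ k i ν b, i ≤ k → ‖W (k + 1) i ν b - W k i ν b‖ ≤ σ * θc ^ k / (lev L i : ℕ))
    {P₄ : (k : ℕ) → Matrix (idx L M k × o) (idx L M k × o) ℂ} {κ₄ C₄ : ℝ}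
    (hP₄ : PerturbationLaws (fun k => calDalev L M a ha k ⊗ₖ (1 : Matrix o o ℂ)) P₄ (fun k => JpcT L M k ⊗ₖ (1 : Matrix o o ℂ)) κ₄ (fun k => C₄ * ρ ^ k))
    (hsmall : kappaB o d a αR βR C (kappaQ d a (a : ℂ) (Fintype.card o * (Real.exp ((((d + 1) * L : ℕ) : ℝ) * α) - 1))) κ₄ < 1) :
    TowerLimitRate (fun k => Qlev L M k ⊗ₖ (1 : Matrix o o ℂ)) ((L : ℝ) ^ d)
      (fun k => (calDalev L M a ha k ⊗ₖ (1 : Matrix o o ℂ) + tierBPert L M R (avgPertT L M a fun k => TBal L M (W k) k) P₄ k)⁻¹)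
      (Cpert (kappaB o d a αR βR C (kappaQ d a (a : ℂ) (Fintype.card o * (Real.exp ((((d + 1) * L : ℕ) : ℝ) * α) - 1))) κ₄) (2 * d * Cst d a) (CJ d a)
        (C2B o d L a αR βR C
          (a * C2gram (Cst d a) 1 (Fintype.card o * (Real.exp ((((d + 1) * L : ℕ) : ℝ) * α) - 1)) (2 * d * Cst d a) (CJ d a) (Cst d a)
            (Cst d a * Fintype.card o * (thetaZero d L α σ + (Real.exp ((((d + 1) * L : ℕ) : ℝ) * α) - 1)))) C₄) 0 1) ρ := by
  have hL1 : 1 ≤ L := by omega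
  have hLr : (1 : ℝ) ≤ L := by exact_mod_cast hL1
  have hρL : ((L : ℝ)⁻¹) ≤ ρ := by
    refine le_trans ?_ hρ
    rw [div_eq_mul_inv, mul_inv, ← mul_assoc]
    have : (0 : ℝ) ≤ (L : ℝ)⁻¹ := inv_nonneg.mpr (by linarith)
    nlinarith
  have hτ : 0 ≤ Real.exp ((((d + 1) * L : ℕ) : ℝ) * α) - 1 := by
    linarith [Real.add_one_le_exp ((((d + 1) * L : ℕ) : ℝ) * α), (by positivity : (0 : ℝ) ≤ (((d + 1) * L : ℕ) : ℝ) * α)]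
  -- the three slots at rate ρ
  have hP₃ := perturbationLaws_avgPertT_rate L M a ha (by positivity) hρL (averagingLaws_EcovT_TBal L M a ha hL hα hσ hθ0 hθ1 hθρ hρ hWn hWa hWc)
  have hP₁ := perturbationLaws_rate_mono L (C2col_nonneg_of_regular L M a ha hd hreg hC hNE3) hρL
    (perturbationLaws_covariantLaplacian_of_regular L M a ha hd hreg hC hNE3)
  have hsum := perturbationLaws_add₃ hP₁ hP₃ hP₄
  have h := towerLimitRate_perturbed_king_kron_rate L M a ha hρL hρ1 hsum (t := 1) (by rw [norm_one, one_mul]; exact hsmall)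
  simpa only [one_smul, tierBPert, kappaB, C2B] using h

end Data

end Summit.QuantumFields.BalabanUV.T4Continuum.NE2.ComposedAveragingRate

end
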